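import Literature.NumberTheory.ComplexMultiplication.EllipticUnits.ThetaValueOneModelLattice
import Literature.NumberTheory.EllipticCurves.ComplexTorusAddProofs
import HarnessLib

/-!
# de Shalit's division points `u_n = w_n − Ω/π₀ⁿ`, `w_n = βⁿΩ` on the model lattice `L = Ω·𝔣`: lattice algebra and orders
# (de Shalit II.4.4 Definition «`w_n − u_n ≡ Ω mod 𝔭ⁿL`», (iv) «`u_n` primitive of level `𝔭ⁿ`, `u_n ≡ u_{n−1}`» — proofs only)

Topic `NumberTheory/ComplexMultiplication/EllipticUnits` (theorems only; no definition, no named fact, no instance).  Cell `bsd-print-cf2`,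
width seat `bsd-line-cf2c-w4` g15, brick «B-lat» of the memo `ALPHA-ASSEMBLY-w4g15.md` §3: the COMPLEX side of de Shalit's torsion points feeding
the chart identity (he) of the bridge.  Data: the model lattice `L = Ω·ι(𝔣)` (`hL`, as in `ThetaValueOneModelLattice`), `Ω ≠ 0`, `𝔣 ≠ 𝒪_K`;
`π₀ ∈ 𝒪_K` (the generator `ψ(𝔭)` of the split prime) and `β ∈ 𝒪_K` with `βπ₀ − 1 ∈ 𝔣` (an inverse of `π₀` modulo `𝔣`).  With
`w_n := ι(βⁿ)·Ω` (the `𝔣`-division point with `σ_𝔭ⁿ ξ(w_n) = ξ(Ω)`, `GrossencharacterFrobeniusInverse`) and `q_n := Ω/ι(π₀ⁿ)` (the point at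
which `Θ(·; L, 𝔞)` takes the value `e_n(𝔞)`, `ThetaValueOneModelLattice`), de Shalit's `u_n := w_n − q_n`:

* §1 the model lattice: `mul_mem_lattice_iff_of_model` (`Ω·ι c ∈ L ↔ c ∈ 𝔣`), `isCMLattice_of_model`, `mem_idealInvLattice_of_model`
  (`Ω ∈ 𝔣⁻¹L`), `notMem_lattice_of_model` (`Ω ∉ L`), `pow_mul_sub_one_mem` (`(βπ₀)ⁿ − 1 ∈ 𝔣`);
* §2 `w_n`: `mul_pow_mem_idealInvLattice_of_model` (`w_n ∈ 𝔣⁻¹L`), `mul_pow_notMem_lattice_of_model` (`w_n ∉ L`);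
* §3 `u_n`: `pow_mul_divisionPt_eq` (`π₀ⁿ·u_n = Ω·ι((βπ₀)ⁿ − 1) ∈ L`: a `𝔭ⁿ`-division point), ★ `mul_divisionPt_succ_sub_mem`
  (**`π₀·u_{n+1} − u_n ∈ L`** — coherence), ★ `pow_mul_divisionPt_succ_notMem` (**`π₀ⁿ·u_{n+1} ∉ L`** — primitive of level `n+1`, for `π₀` a
  non-unit), `two_pow_mul_divisionPt_mem` / ★ `two_pow_mul_divisionPt_succ_notMem` (`2^{n+1}u_{n+1} ∈ L`, `2ⁿu_{n+1} ∉ L` when `2 = π₀π₁`,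
  `π₀` prime, `π₀ ∤ π₁` — the split prime);
* §4 on the complex curve `E_L(ℂ)` (`PeriodPair.toPoint`, additive by `toPoint_add_holds`): ★ `addOrderOf_toPoint_divisionPt_succ`
  (**`ξ(u_{n+1})` has order exactly `2^{n+1}`**), `toPoint_mul_divisionPt_succ` (**`ξ(π₀·u_{n+1}) = ξ(u_n)`**), `toPoint_divisionPt`
  (`ξ(u_n) = ξ(w_n) − ξ(q_n)`).

No summit statement is proved; BSD is not proved by any of this.

## References
* [deShalit1987] E. de Shalit, *Iwasawa theory of elliptic curves with complex multiplication* (1987), II §4.2 (6), II §4.4 Definition, (iv), (25),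
  II §4.9 (23) and Proposition (ii).
* [SilvermanAEC2009] J. H. Silverman, *The Arithmetic of Elliptic Curves*, 2nd ed. (2009), Prop. VI.3.6 (b).
-/

noncomputable section

open scoped Classical
open NumberField PeriodPair

namespace Literature.NumberTheory.ComplexMultiplication.EllipticUnits

variable {K : Type} [Field K] (ι : K →+* ℂ) {𝔣 : Ideal (𝓞 K)} {L : PeriodPair} {Ω : ℂ}

/-! ## §1 The model lattice `L = Ω·ι(𝔣)` -/

/-- `Ω·ι(c) ∈ L ↔ c ∈ 𝔣` for `c ∈ 𝒪_K` (`Ω ≠ 0`, `ι` injective). [cite: deShalit1987, II §4.2 (6)] -/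
theorem mul_mem_lattice_iff_of_model (hL : ∀ z : ℂ, z ∈ L.lattice ↔ ∃ a ∈ 𝔣, z = Ω * ι (a : K)) (hΩ : Ω ≠ 0) (c : 𝓞 K) :
    Ω * ι (c : K) ∈ L.lattice ↔ c ∈ 𝔣 := by
  rw [hL]
  constructor
  · rintro ⟨a, ha, h⟩
    have hca : (c : K) = a := ι.injective (mul_left_cancel₀ hΩ h)
    rwa [show c = a from Subtype.ext hca]
  · exact fun hc => ⟨c, hc, rfl⟩

/-- `L = Ω·ι(𝔣)` has `𝒪_K`-multiplication. [cite: deShalit1987, II §4.2 (6)] -/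
theorem isCMLattice_of_model (hL : ∀ z : ℂ, z ∈ L.lattice ↔ ∃ a ∈ 𝔣, z = Ω * ι (a : K)) : IsCMLattice ι L.lattice := by
  intro a x hx
  obtain ⟨c, hc, rfl⟩ := (hL x).mp hx
  refine (hL _).mpr ⟨a * c, 𝔣.mul_mem_left a hc, ?_⟩
  push_cast
  rw [map_mul]
  ring

/-- `Ω ∈ 𝔣⁻¹L`. [cite: deShalit1987, II §4.2 (6), §4.4] -/
theorem mem_idealInvLattice_of_model (hL : ∀ z : ℂ, z ∈ L.lattice ↔ ∃ a ∈ 𝔣, z = Ω * ι (a : K)) :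
    Ω ∈ idealInvLattice ι 𝔣 L.lattice :=
  mem_idealInvLattice_iff.mpr fun a ha => (hL _).mpr ⟨a, ha, by ring⟩

/-- `Ω ∉ L` (`𝔣 ≠ 𝒪_K`). [cite: deShalit1987, II §4.2 (6)] -/
theorem notMem_lattice_of_model (hL : ∀ z : ℂ, z ∈ L.lattice ↔ ∃ a ∈ 𝔣, z = Ω * ι (a : K)) (hΩ : Ω ≠ 0) (h𝔣 : 𝔣 ≠ ⊤) :
    Ω ∉ L.lattice := by
  intro h
  have h1 : Ω * ι ((1 : 𝓞 K) : K) ∈ L.lattice := by simpa using h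
  rw [mul_mem_lattice_iff_of_model ι hL hΩ] at h1
  exact h𝔣 ((Ideal.eq_top_iff_one _).mpr h1)

/-- `(βπ₀)ⁿ − 1 ∈ 𝔣` from `βπ₀ − 1 ∈ 𝔣`. [cite: deShalit1987, II §4.4] -/
theorem pow_mul_sub_one_mem {β π₀ : 𝓞 K} (hβ : β * π₀ - 1 ∈ 𝔣) (n : ℕ) : (β * π₀) ^ n - 1 ∈ 𝔣 := by
  induction n with
  | zero => rw [pow_zero, sub_self]; exact 𝔣.zero_mem
  | succ n ih =>
    have e : (β * π₀) ^ (n + 1) - 1 = (β * π₀) * ((β * π₀) ^ n - 1) + (β * π₀ - 1) := by ring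
    rw [e]
    exact 𝔣.add_mem (𝔣.mul_mem_left _ ih) hβ

/-! ## §2 `w_n = ι(βⁿ)·Ω ∈ 𝔣⁻¹L ∖ L` -/

/-- `w_n = ι(βⁿ)·Ω ∈ 𝔣⁻¹L`. [cite: deShalit1987, II §4.4 (25)] -/
theorem mul_pow_mem_idealInvLattice_of_model (hL : ∀ z : ℂ, z ∈ L.lattice ↔ ∃ a ∈ 𝔣, z = Ω * ι (a : K)) (β : 𝓞 K) (n : ℕ) :
    ι ((β ^ n : 𝓞 K) : K) * Ω ∈ idealInvLattice ι 𝔣 L.lattice := by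
  refine mem_idealInvLattice_iff.mpr fun a ha => (hL _).mpr ⟨a * β ^ n, 𝔣.mul_mem_right _ ha, ?_⟩
  push_cast
  rw [map_mul, map_pow]
  ring

/-- `w_n = ι(βⁿ)·Ω ∉ L` (`β` is a unit modulo `𝔣 ≠ 𝒪_K`). [cite: deShalit1987, II §4.4 (25)] -/
theorem mul_pow_notMem_lattice_of_model (hL : ∀ z : ℂ, z ∈ L.lattice ↔ ∃ a ∈ 𝔣, z = Ω * ι (a : K)) (hΩ : Ω ≠ 0) (h𝔣 : 𝔣 ≠ ⊤)
    {β π₀ : 𝓞 K} (hβ : β * π₀ - 1 ∈ 𝔣) (n : ℕ) : ι ((β ^ n : 𝓞 K) : K) * Ω ∉ L.lattice := by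
  intro h
  rw [mul_comm, mul_mem_lattice_iff_of_model ι hL hΩ] at h
  have h1 : (β ^ n * π₀ ^ n : 𝓞 K) ∈ 𝔣 := 𝔣.mul_mem_right _ h
  have h2 := pow_mul_sub_one_mem hβ n
  rw [mul_pow] at h2
  have h3 : (1 : 𝓞 K) ∈ 𝔣 := by simpa using 𝔣.sub_mem h1 h2
  exact h𝔣 ((Ideal.eq_top_iff_one _).mpr h3)

/-! ## §3 `u_n = ι(βⁿ)·Ω − Ω/ι(π₀ⁿ)` -/

section DivisionPt

variable (hL : ∀ z : ℂ, z ∈ L.lattice ↔ ∃ a ∈ 𝔣, z = Ω * ι (a : K)) {β π₀ : 𝓞 K}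

/-- `ι(π₀ⁿ)·u_n = Ω·ι((βπ₀)ⁿ − 1)`. [cite: deShalit1987, II §4.4 Definition] -/
theorem pow_mul_divisionPt_eq (hπ₀ : π₀ ≠ 0) (β : 𝓞 K) (n : ℕ) :
    ι ((π₀ ^ n : 𝓞 K) : K) * (ι ((β ^ n : 𝓞 K) : K) * Ω - Ω / ι ((π₀ ^ n : 𝓞 K) : K)) =
      Ω * ι ((((β * π₀) ^ n - 1 : 𝓞 K)) : K) := by
  have h0 : ι (π₀ : K) ≠ 0 := (map_ne_zero ι).mpr (by exact_mod_cast hπ₀)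
  push_cast
  simp only [map_pow, map_mul, map_sub, map_one]
  field_simp
  ring

include hL in
/-- `ι(π₀ⁿ)·u_n ∈ L`: `u_n` is a `𝔭ⁿ`-division point (`𝔭 = (π₀)`). [cite: deShalit1987, II §4.4 (iv)] -/
theorem pow_mul_divisionPt_mem (hβ : β * π₀ - 1 ∈ 𝔣) (hπ₀ : π₀ ≠ 0) (n : ℕ) :
    ι ((π₀ ^ n : 𝓞 K) : K) * (ι ((β ^ n : 𝓞 K) : K) * Ω - Ω / ι ((π₀ ^ n : 𝓞 K) : K)) ∈ L.lattice := by
  rw [pow_mul_divisionPt_eq ι hπ₀, hL]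
  exact ⟨_, pow_mul_sub_one_mem hβ n, rfl⟩

include hL in
/-- ★ **Coherence: `ι(π₀)·u_{n+1} − u_n ∈ L`** (de Shalit's `u_n ≡ u_{n−1} mod 𝔭^{n−1}L`, here for the points scaled to `𝔭⁻ⁿL/L`).
[cite: deShalit1987, II §4.4 (iv)] -/
theorem mul_divisionPt_succ_sub_mem (hβ : β * π₀ - 1 ∈ 𝔣) (hπ₀ : π₀ ≠ 0) (n : ℕ) :
    ι (π₀ : K) * (ι ((β ^ (n + 1) : 𝓞 K) : K) * Ω - Ω / ι ((π₀ ^ (n + 1) : 𝓞 K) : K)) -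
        (ι ((β ^ n : 𝓞 K) : K) * Ω - Ω / ι ((π₀ ^ n : 𝓞 K) : K)) ∈ L.lattice := by
  have h0 : ι (π₀ : K) ≠ 0 := (map_ne_zero ι).mpr (by exact_mod_cast hπ₀)
  have e : ι (π₀ : K) * (ι ((β ^ (n + 1) : 𝓞 K) : K) * Ω - Ω / ι ((π₀ ^ (n + 1) : 𝓞 K) : K)) -
      (ι ((β ^ n : 𝓞 K) : K) * Ω - Ω / ι ((π₀ ^ n : 𝓞 K) : K)) = Ω * ι (((β ^ n * (β * π₀ - 1) : 𝓞 K)) : K) := by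
    push_cast
    simp only [map_pow, map_mul, map_sub, map_one]
    field_simp
    ring
  rw [e, hL]
  exact ⟨_, 𝔣.mul_mem_left _ hβ, rfl⟩

/-- `ι(π₀)·(ι(π₀ⁿ)·u_{n+1}) = Ω·ι((βπ₀)^{n+1} − 1)`. [cite: deShalit1987, II §4.4 (iv)] -/
theorem mul_pow_mul_divisionPt_succ_eq (hπ₀ : π₀ ≠ 0) (β : 𝓞 K) (n : ℕ) :
    ι (π₀ : K) * (ι ((π₀ ^ n : 𝓞 K) : K) * (ι ((β ^ (n + 1) : 𝓞 K) : K) * Ω - Ω / ι ((π₀ ^ (n + 1) : 𝓞 K) : K))) =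
      Ω * ι ((((β * π₀) ^ (n + 1) - 1 : 𝓞 K)) : K) := by
  rw [← mul_assoc, ← map_mul, ← pow_mul_divisionPt_eq ι hπ₀ β (n + 1)]
  push_cast
  ring

include hL in
/-- ★ **Primitive of level `n + 1`: `ι(π₀ⁿ)·u_{n+1} ∉ L`** when `π₀ ≠ 0` is not a unit (`(βπ₀)^{n+1} − 1 ≡ −1 (mod π₀)`).
[cite: deShalit1987, II §4.4 (iv)] -/
theorem pow_mul_divisionPt_succ_notMem (hΩ : Ω ≠ 0) (hπ₀ : π₀ ≠ 0) (hu : ¬ IsUnit π₀) (n : ℕ) :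
    ι ((π₀ ^ n : 𝓞 K) : K) * (ι ((β ^ (n + 1) : 𝓞 K) : K) * Ω - Ω / ι ((π₀ ^ (n + 1) : 𝓞 K) : K)) ∉ L.lattice := by
  intro h
  obtain ⟨a, ha, h⟩ := (hL _).mp h
  have e := mul_pow_mul_divisionPt_succ_eq ι (Ω := Ω) hπ₀ β n
  rw [h, mul_left_comm, ← map_mul ι] at e
  have hc : ((π₀ : K) * (a : K)) = (((β * π₀) ^ (n + 1) - 1 : 𝓞 K) : K) := ι.injective (mul_left_cancel₀ hΩ e)
  have hc' : π₀ * a = (β * π₀) ^ (n + 1) - 1 := by exact_mod_cast hc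
  -- `π₀ a = (βπ₀)^{n+1} − 1` ⇒ `π₀ · (β(βπ₀)ⁿ − a) = 1`
  exact hu (IsUnit.of_mul_eq_one (β * (β * π₀) ^ n - a) (by linear_combination -hc'))

/-- `2 = π₀π₁` read in `ℂ`: `2ⁿ = ι(π₁ⁿ)·ι(π₀ⁿ)`. [cite: deShalit1987, II §4.1] -/
theorem two_pow_eq_of_split {π₁ : 𝓞 K} (h2 : (2 : 𝓞 K) = π₀ * π₁) (n : ℕ) :
    (2 : ℂ) ^ n = ι ((π₁ ^ n : 𝓞 K) : K) * ι ((π₀ ^ n : 𝓞 K) : K) := by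
  have h : (ι.comp (algebraMap (𝓞 K) K)) 2 = (ι.comp (algebraMap (𝓞 K) K)) (π₀ * π₁) := by rw [h2]
  rw [map_ofNat, map_mul, RingHom.comp_apply, RingHom.comp_apply, ← RingOfIntegers.coe_eq_algebraMap,
    ← RingOfIntegers.coe_eq_algebraMap] at h
  push_cast
  rw [map_pow, map_pow, h, mul_pow, mul_comm]

include hL in
/-- `2ⁿ·u_n ∈ L` when `2 = π₀π₁`. [cite: deShalit1987, II §4.4 (iv)] -/
theorem two_pow_mul_divisionPt_mem (hβ : β * π₀ - 1 ∈ 𝔣) (hπ₀ : π₀ ≠ 0) {π₁ : 𝓞 K} (h2 : (2 : 𝓞 K) = π₀ * π₁) (n : ℕ) :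
    (2 : ℂ) ^ n * (ι ((β ^ n : 𝓞 K) : K) * Ω - Ω / ι ((π₀ ^ n : 𝓞 K) : K)) ∈ L.lattice := by
  rw [two_pow_eq_of_split ι h2, mul_assoc]
  exact isCMLattice_of_model ι hL _ _ (pow_mul_divisionPt_mem ι hL hβ hπ₀ n)

include hL in
/-- ★ **`2ⁿ·u_{n+1} ∉ L`** when `2 = π₀π₁` with `π₀` prime and `π₀ ∤ π₁` (the split prime `2 = 𝔭𝔭̄`): `ξ(u_{n+1})` has order exactly `2^{n+1}`.
[cite: deShalit1987, II §4.4 (iv)] -/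
theorem two_pow_mul_divisionPt_succ_notMem (hΩ : Ω ≠ 0) {π₁ : 𝓞 K} (h2 : (2 : 𝓞 K) = π₀ * π₁) (hp : Prime π₀)
    (hπ₁ : ¬ π₀ ∣ π₁) (n : ℕ) :
    (2 : ℂ) ^ n * (ι ((β ^ (n + 1) : 𝓞 K) : K) * Ω - Ω / ι ((π₀ ^ (n + 1) : 𝓞 K) : K)) ∉ L.lattice := by
  intro h
  have hπ0 : π₀ ≠ 0 := hp.ne_zero
  rw [two_pow_eq_of_split ι h2, mul_assoc] at h
  obtain ⟨a, ha, h⟩ := (hL _).mp h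
  -- multiply by `ι π₀`: `ι(π₁ⁿ)·Ω·ι((βπ₀)^{n+1} − 1) = ι π₀ · Ω · ι a`
  have e := mul_pow_mul_divisionPt_succ_eq ι (Ω := Ω) hπ0 β n
  have e2 : Ω * (ι ((π₁ ^ n : 𝓞 K) : K) * ι ((((β * π₀) ^ (n + 1) - 1 : 𝓞 K)) : K)) = Ω * (ι (π₀ : K) * ι (a : K)) := by
    linear_combination (-ι ((π₁ ^ n : 𝓞 K) : K)) * e + ι (π₀ : K) * h
  have e3 := mul_left_cancel₀ hΩ e2
  rw [← map_mul ι, ← map_mul ι] at e3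
  have hc : ((π₁ ^ n : 𝓞 K) : K) * (((β * π₀) ^ (n + 1) - 1 : 𝓞 K) : K) = (π₀ : K) * (a : K) := ι.injective e3
  have hc' : π₁ ^ n * ((β * π₀) ^ (n + 1) - 1) = π₀ * a := by exact_mod_cast hc
  have hdvd : π₀ ∣ π₁ ^ n * ((β * π₀) ^ (n + 1) - 1) := ⟨a, hc'⟩
  rcases hp.dvd_or_dvd hdvd with h1 | h1
  · exact hπ₁ (hp.dvd_of_dvd_pow h1)
  · have h4 : π₀ ∣ (β * π₀) ^ (n + 1) := Dvd.intro_left (β * (β * π₀) ^ n) (by ring)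
    have h3 : π₀ ∣ (β * π₀) ^ (n + 1) - ((β * π₀) ^ (n + 1) - 1) := dvd_sub h4 h1
    rw [sub_sub_cancel] at h3
    exact hp.not_unit (isUnit_of_dvd_one h3)

/-! ## §4 On the complex curve `E_L(ℂ)` -/

/-- `k • ξ(z) = ξ(k·z)` (`ξ` is additive, `toPoint_add_holds`). [cite: SilvermanAEC2009, Prop. VI.3.6 (b)] -/
theorem nsmul_toPoint_eq (L : PeriodPair) (k : ℕ) (z : ℂ) : k • L.toPoint z = L.toPoint ((k : ℂ) * z) := by
  rw [← toPointHom_apply (toPoint_add_holds L), ← map_nsmul, nsmul_eq_mul, toPointHom_apply]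

include hL in
/-- ★ **`ξ(u_{n+1})` has order exactly `2^{n+1}`** on `E_L(ℂ)` (`ξ = PeriodPair.toPoint`, additive by `toPoint_add_holds`).
[cite: deShalit1987, II §4.4 (iv)] [cite: SilvermanAEC2009, Prop. VI.3.6 (b)] -/
theorem addOrderOf_toPoint_divisionPt_succ (hΩ : Ω ≠ 0) (hβ : β * π₀ - 1 ∈ 𝔣) {π₁ : 𝓞 K} (h2 : (2 : 𝓞 K) = π₀ * π₁)
    (hp : Prime π₀) (hπ₁ : ¬ π₀ ∣ π₁) (n : ℕ) :
    addOrderOf (L.toPoint (ι ((β ^ (n + 1) : 𝓞 K) : K) * Ω - Ω / ι ((π₀ ^ (n + 1) : 𝓞 K) : K))) = 2 ^ (n + 1) := by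
  refine addOrderOf_eq_prime_pow (p := 2) (n := n) ?_ ?_
  · intro h0
    rw [nsmul_toPoint_eq, toPoint_eq_zero_iff, Nat.cast_pow, Nat.cast_ofNat] at h0
    exact two_pow_mul_divisionPt_succ_notMem ι hL hΩ h2 hp hπ₁ n h0
  · rw [nsmul_toPoint_eq, toPoint_eq_zero_iff, Nat.cast_pow, Nat.cast_ofNat]
    exact two_pow_mul_divisionPt_mem ι hL hβ hp.ne_zero h2 (n + 1)

include hL in
/-- ★ **`ξ(ι(π₀)·u_{n+1}) = ξ(u_n)`** (coherence on the curve). [cite: deShalit1987, II §4.4 (iv)] -/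
theorem toPoint_mul_divisionPt_succ (hβ : β * π₀ - 1 ∈ 𝔣) (hπ₀ : π₀ ≠ 0) (n : ℕ) :
    L.toPoint (ι (π₀ : K) * (ι ((β ^ (n + 1) : 𝓞 K) : K) * Ω - Ω / ι ((π₀ ^ (n + 1) : 𝓞 K) : K))) =
      L.toPoint (ι ((β ^ n : 𝓞 K) : K) * Ω - Ω / ι ((π₀ ^ n : 𝓞 K) : K)) := by
  have h := mul_divisionPt_succ_sub_mem ι hL hβ hπ₀ n
  rw [← toPoint_add_coe (L := L) (ι ((β ^ n : 𝓞 K) : K) * Ω - Ω / ι ((π₀ ^ n : 𝓞 K) : K)) ⟨_, h⟩]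
  congr 1
  simp only
  ring

/-- `ξ(u_n) = ξ(w_n) − ξ(q_n)`. [cite: deShalit1987, II §4.4 Definition] [cite: SilvermanAEC2009, Prop. VI.3.6 (b)] -/
theorem toPoint_divisionPt (β π₀ : 𝓞 K) (n : ℕ) :
    L.toPoint (ι ((β ^ n : 𝓞 K) : K) * Ω - Ω / ι ((π₀ ^ n : 𝓞 K) : K)) =
      L.toPoint (ι ((β ^ n : 𝓞 K) : K) * Ω) - L.toPoint (Ω / ι ((π₀ ^ n : 𝓞 K) : K)) := by
  rw [← toPointHom_apply (toPoint_add_holds L), ← toPointHom_apply (toPoint_add_holds L),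
    ← toPointHom_apply (toPoint_add_holds L), map_sub]

end DivisionPt

/-! ## §5 Appended (g15): non-membership of the auxiliary arguments `u_{n+1}`, `Ω + u_n`, `π₀(Ω + u_{n+1})`, `π₀Ω` -/

section NotMem

variable (hL : ∀ z : ℂ, z ∈ L.lattice ↔ ∃ a ∈ 𝔣, z = Ω * ι (a : K)) {β π₀ : 𝓞 K}

include hL in
/-- **`u_{n+1} ∉ L`** (else `2ⁿu_{n+1} ∈ L`, against `two_pow_mul_divisionPt_succ_notMem`). [cite: deShalit1987, II §4.4 (iv)] -/
theorem divisionPt_succ_notMem (hΩ : Ω ≠ 0) {π₁ : 𝓞 K} (h2 : (2 : 𝓞 K) = π₀ * π₁) (hp : Prime π₀) (hπ₁ : ¬ π₀ ∣ π₁) (n : ℕ) :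
    ι ((β ^ (n + 1) : 𝓞 K) : K) * Ω - Ω / ι ((π₀ ^ (n + 1) : 𝓞 K) : K) ∉ L.lattice := by
  intro h
  refine two_pow_mul_divisionPt_succ_notMem ι hL hΩ (β := β) h2 hp hπ₁ n ?_
  have h1 := isCMLattice_of_model ι hL ((2 : 𝓞 K) ^ n) _ h
  have e2 : ι ((((2 : 𝓞 K) ^ n : 𝓞 K)) : K) = (2 : ℂ) ^ n := by
    rw [RingOfIntegers.coe_eq_algebraMap, ← RingHom.comp_apply, map_pow, map_ofNat]
  rwa [e2] at h1

include hL in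
/-- **`Ω·ι(π₀) ∉ L`** iff `π₀ ∉ 𝔣` (`mul_mem_lattice_iff_of_model`). [cite: deShalit1987, II §4.2 (6)] -/
theorem mul_gen_notMem (hΩ : Ω ≠ 0) (hπ₀𝔣 : π₀ ∉ 𝔣) : ι (π₀ : K) * Ω ∉ L.lattice := by
  rw [mul_comm, mul_mem_lattice_iff_of_model ι hL hΩ]
  exact hπ₀𝔣

include hL in
/-- **`Ω + u_n ∉ L`** when `π₀ⁿ ∉ 𝔣` (`ι(π₀ⁿ)(Ω + u_n) = Ω·ι(π₀ⁿ + (βπ₀)ⁿ − 1)` and `(βπ₀)ⁿ − 1 ∈ 𝔣`). [cite: deShalit1987, II §4.4 (iv)] -/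
theorem add_divisionPt_notMem (hΩ : Ω ≠ 0) (hβ : β * π₀ - 1 ∈ 𝔣) (hπ₀ : π₀ ≠ 0) {n : ℕ} (hπ₀n : (π₀ ^ n : 𝓞 K) ∉ 𝔣) :
    Ω + (ι ((β ^ n : 𝓞 K) : K) * Ω - Ω / ι ((π₀ ^ n : 𝓞 K) : K)) ∉ L.lattice := by
  intro h
  have h1 := isCMLattice_of_model ι hL (π₀ ^ n) _ h
  rw [mul_add, pow_mul_divisionPt_eq ι hπ₀, mul_comm (ι _) Ω, ← mul_add, ← map_add, show ((π₀ ^ n : 𝓞 K) : K) +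
    ((((β * π₀) ^ n - 1 : 𝓞 K)) : K) = (((π₀ ^ n + ((β * π₀) ^ n - 1) : 𝓞 K)) : K) by push_cast; ring,
    mul_mem_lattice_iff_of_model ι hL hΩ] at h1
  exact hπ₀n (by simpa using 𝔣.sub_mem h1 (pow_mul_sub_one_mem hβ n))

include hL in
/-- **`ι(π₀)·(Ω + u_{n+1}) ∉ L`** when `π₀^{n+1} ∉ 𝔣` (multiply by `ι(π₀ⁿ)`: `Ω·ι(π₀^{n+1} + (βπ₀)^{n+1} − 1)`).
[cite: deShalit1987, II §4.4 (iv)] -/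
theorem mul_add_divisionPt_succ_notMem (hΩ : Ω ≠ 0) (hβ : β * π₀ - 1 ∈ 𝔣) (hπ₀ : π₀ ≠ 0) {n : ℕ}
    (hπ₀n : (π₀ ^ (n + 1) : 𝓞 K) ∉ 𝔣) :
    ι (π₀ : K) * (Ω + (ι ((β ^ (n + 1) : 𝓞 K) : K) * Ω - Ω / ι ((π₀ ^ (n + 1) : 𝓞 K) : K))) ∉ L.lattice := by
  intro h
  have h1 := isCMLattice_of_model ι hL (π₀ ^ n) _ h
  have e1 := mul_pow_mul_divisionPt_succ_eq ι (Ω := Ω) hπ₀ β n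
  have e : ι ((π₀ ^ n : 𝓞 K) : K) * (ι (π₀ : K) * (Ω + (ι ((β ^ (n + 1) : 𝓞 K) : K) * Ω - Ω / ι ((π₀ ^ (n + 1) : 𝓞 K) : K)))) =
      Ω * ι ((((π₀ ^ (n + 1) + ((β * π₀) ^ (n + 1) - 1) : 𝓞 K)) : K)) := by
    push_cast at e1 ⊢
    simp only [map_add, map_sub, map_mul, map_pow, map_one] at e1 ⊢
    linear_combination e1
  rw [e, mul_mem_lattice_iff_of_model ι hL hΩ] at h1
  exact hπ₀n (by simpa using 𝔣.sub_mem h1 (pow_mul_sub_one_mem hβ (n + 1)))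

end NotMem

end Literature.NumberTheory.ComplexMultiplication.EllipticUnits

end
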